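import Summits.ResolutionOfSingularities.ResolutionOfSingularities.Theorems.EquisingularLiftEquisingularLiftNatTowerRoundFourDefs
import Literature.AlgebraicGeometry.Resolution.ProjectiveSpaceRegular
import HarnessLib

/-!
# Route `EquisingularLift`, crux EL♮ (stmt-ResolutionOfSingularities-20038) / EL♮(3) (stmt-…-20148) — rungs TOWER / NOSE-TOWER, revision ₆:
# GENUS-FREE Čech rounds (any irreducible regular curve of the running exceptional surface with `H¹(𝒩) = 0`) and NON-RATIONAL noses
# — append-only successor of …NatTowerRoundFourDefs (p594791)

res-L1-w45b-lead-2 g4 (lead, text owner), TWENTIETH registered-text event (split of the non-isolated research residue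
`stub_elnat_three_nonisolated_nonRatNoseTower` on res-L1-w45b-stub-4's RESIDUE-2 census 598f05d6100306f2, stratum (R2-a) «non-rational noses needing
rounds», and the matching upgrade of the isolated rung). OURS; planning vocabulary of the crux chain, not a statement of any manuscript
([Hironaka2017] is a candidate under adjudication, D-0012/D-0089, nothing of it is asserted here); AI-written, weaker than expert review. Definitions
+ pure-logic lemmas only (no `sorry`, standard axioms).

WHY. Under design D2 (…NatTowerRoundFourDefs) the upstairs supplier of a Čech round is the hypothesis-residue (T-k) `EmbeddedCurveLiftFact`, which is
CARRIER-AGNOSTIC (any regular `Z̃ ⊆ Ẽ` with `H¹(Z̃, 𝒩_{Z̃/Ẽ}) = 0`). Revision ₅ still asked `RationalCarrier Z̃` on the new disjunct and revision ₄ of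
the nose tower still asked a RATIONAL nose (`Z̃ ≅ ℙ¹_k`) — both only ever served the (L)/T-P1VB supplier. Revision ₆ drops them:
* `TowerRound₅` — `TowerRound₄` whose new disjunct reads `IsIrreducible Z ∧ (Z̃ regular) ∧ G regular along Z̃ ∧ Ẽ regular along Z̃ ∧ DirStepUnobs`
  (no rationality, no degree: sections OR multisections of the running exceptional surface over a carrier of ANY genus); the ₃ section disjuncts
  and the cone disjunct verbatim.
* `ReachTower₆` — `ReachTower₅` with `TowerRound₅`; `ReachNoseTower₆` — `ReachNoseTower₄` WITHOUT the clause `Nonempty (Z̃ ≅ ℙ¹_k)` (noses of any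
  genus in the liftable class₂; the first centre is still lifted by `IsLiftableNoseClass₂`) and with `TowerRound₅`.
* forgetful lemmas `towerRound₄_of_towerRound₅`, `reachTower₆_of_reachTower₅`, `reachNoseTower₆_of_reachNoseTower₅` (₅ ⊆ ₆, pure logic).
Residue census after ₆ (docstrings of the registered residues): Čech rounds with `H¹(𝒩) ≠ 0`; first centres outside class₂ (LIFT₃ proper);
junction atoms / jumps; TERMINATION-MATCH (CJS 2009-type clock); everything modulo (T-k).
-/

set_option linter.dupNamespace false

noncomputable section

open CategoryTheory AlgebraicGeometry TopologicalSpace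
open Literature.AlgebraicGeometry.Resolution
open AlgebraicGeometry.Scheme.IdealSheafData

namespace Summit.ResolutionOfSingularities.ResolutionOfSingularities.Cruxes.EquisingularLiftNat.Sections

/-- **TOWER / (round), revision ₅ — genus-free Čech rounds.** `TowerRound₄` with `RationalCarrier (redSub G Z hZ)` of the new disjunct replaced by
«`Z̃` regular» (every stalk of the reduced centre is a regular local ring): rounds along ANY irreducible regular curve of the running exceptional
surface — section or multisection, any genus — with `G`, `Ẽ` regular along it and `H¹(Z̃, 𝒩_{Z̃/Ẽ}) = 0` (`DirStepUnobs`). Downstairs only.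
[OURS · planning vocabulary] -/
def TowerRound₅ (F₉ F₁₀ : Scheme.{0}) (υ' : F₁₀ ⟶ F₉) (Z₉ : Set F₉) (hZ₉ : IsClosed Z₉)
    (R₁ : ∀ G : Scheme.{0}, (G ⟶ F₁₀) → Set G → Set G → Set G → Prop) : Prop :=
  ∀ (G G' : Scheme.{0}) (γ : G ⟶ F₁₀) (T E K : Set G) (hE : IsClosed E) (Z : Set G) (hZ : IsClosed Z) (υ₂ : G' ⟶ G) (K' : Set G'),
    R₁ G γ T E K →
    Z ⊆ E ∩ T → Z.Nonempty →
    TowerFull F₉ F₁₀ υ' Z₉ hZ₉ G γ Z hZ →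
    ((DirStepSec F₉ F₁₀ υ' Z₉ hZ₉ G γ Z hZ ∧
        ((RationalCarrier (redSub F₉ Z₉ hZ₉) ∧
            (∀ x : redSub G Z hZ, IsRegularLocalRing (G.presheaf.stalk (redSubι G Z hZ x))) ∧
            (∀ (i : redSub G Z hZ ⟶ redSub G E hE), i ≫ redSubι G E hE = redSubι G Z hZ →
              ∀ x : redSub G Z hZ, IsRegularLocalRing ((redSub G E hE).presheaf.stalk (i x))) ∧
            DirStepUnobs G E hE Z hZ) ∨
          ConeWitness G E hE K Z hZ)) ∨
      (IsIrreducible Z ∧ (∀ x : redSub G Z hZ, IsRegularLocalRing ((redSub G Z hZ).presheaf.stalk x)) ∧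
        (∀ x : redSub G Z hZ, IsRegularLocalRing (G.presheaf.stalk (redSubι G Z hZ x))) ∧
        (∀ (i : redSub G Z hZ ⟶ redSub G E hE), i ≫ redSubι G E hE = redSubι G Z hZ →
          ∀ x : redSub G Z hZ, IsRegularLocalRing ((redSub G E hE).presheaf.stalk (i x))) ∧
        DirStepUnobs G E hE Z hZ)) →
    IsBlowup υ₂ (Scheme.IdealSheafData.vanishingIdeal (⟨Z, hZ⟩ : Closeds G)) →
    (K' = ∅ ∨ ((ConeWitness G E hE K Z hZ ∨ closure (Z \ closure K) = Z) ∧ K' = closure (υ₂ ⁻¹' (K \ Z)))) →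
    R₁ G' (υ₂ ≫ γ) (closure (υ₂ ⁻¹' (T \ Z))) (υ₂ ⁻¹' Z) K' ∧
      R₁ G' (υ₂ ≫ γ) (closure (υ₂ ⁻¹' (T \ Z))) (closure (υ₂ ⁻¹' (E \ Z))) K'

/-- **ReachTower₆** — `ReachTower₅` with `TowerRound₅` (genus-free Čech rounds). Downstairs only; K5′'s `Reach` slot. [OURS · planning vocabulary] -/
def ReachTower₆ (F₁ F₂ : Scheme.{0}) (υ : F₂ ⟶ F₁) (x : F₁) (T₂ : Set F₂) (F' : Scheme.{0}) (β : F' ⟶ F₂) (T' : Set F') : Prop :=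
  ∃ (W : Set F₁) (K₂ : Set F₂) (F₉ : Scheme.{0}) (β₉ : F₉ ⟶ F₂) (T₉ Z₉ K₉ : Set F₉) (b₉ : Bool) (hZ₉ : IsClosed Z₉)
    (F₁₀ : Scheme.{0}) (υ' : F₁₀ ⟶ F₉) (γ' : F' ⟶ F₁₀) (E' K' : Set F'),
    x ∈ W ∧ ¬ (υ ⁻¹' {x} ⊆ closure (υ ⁻¹' (W \ {x}))) ∧
    (∃ U : F₁.affineOpens, x ∈ (U : F₁.Opens) ∧
      ((Scheme.IdealSheafData.vanishingIdeal (⟨closure W, isClosed_closure⟩ : Closeds F₁)).ideal U).IsPrincipal) ∧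
    υ ⁻¹' {x} ∩ closure (υ ⁻¹' (W \ {x})) ⊆ T₂ ∧
    (K₂ = ∅ ∨ (ConeForm F₁ x W ∧ K₂ = closure (υ ⁻¹' (W \ {x})))) ∧
    InCarrierReachK F₂ T₂ (υ ⁻¹' {x} ∩ closure (υ ⁻¹' (W \ {x}))) K₂ F₉ β₉ T₉ Z₉ K₉ b₉ ∧
    Z₉ ⊆ T₉ ∧ ¬ (T₉ ⊆ Z₉) ∧ Z₉.Infinite ∧
    Set.Finite {z : redSub F₉ Z₉ hZ₉ | ¬ IsRegularLocalRing ((redSub F₉ Z₉ hZ₉).presheaf.stalk z)} ∧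
    IsBlowup υ' (Scheme.IdealSheafData.vanishingIdeal (⟨Z₉, hZ₉⟩ : Closeds F₉)) ∧
    (∀ R₁ : (∀ G : Scheme.{0}, (G ⟶ F₁₀) → Set G → Set G → Set G → Prop),
      R₁ F₁₀ (𝟙 F₁₀) (closure (υ' ⁻¹' (T₉ \ Z₉))) (υ' ⁻¹' Z₉) (closure (υ' ⁻¹' (K₉ \ Z₉))) →
      TowerPtReg₂ F₉ F₁₀ υ' R₁ → TowerPtRam₂ F₉ F₁₀ υ' R₁ → TowerRound₅ F₉ F₁₀ υ' Z₉ hZ₉ R₁ → R₁ F' γ' T' E' K') ∧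
    β = (γ' ≫ υ') ≫ β₉

/-- **NOSE-TOWER, revision ₆ — noses of any genus.** `ReachNoseTower₄` WITHOUT the clause `Nonempty (Z̃ ≅ ℙ¹_k)` (the nose `Z` is any infinite
closed set of the liftable class₂ inside `ι(H)`, not all of it) and with `TowerRound₅` (genus-free Čech rounds). Downstairs only.
[OURS · planning vocabulary] -/
def ReachNoseTower₆ (k : Type) [Field k] (n : ℕ) (H : Scheme.{0})
    (ι : H ⟶ (Literature.AlgebraicGeometry.Motives.projectiveSpace n k).left) : Prop :=
  ∃ (Z : Set (Literature.AlgebraicGeometry.Motives.projectiveSpace n k).left) (hZ : IsClosed Z),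
    IsLiftableNoseClass₂ k n Z ∧ Z ⊆ Set.range ι ∧ ¬ (Set.range ι ⊆ Z) ∧ Z.Infinite ∧
    ∃ (F₂ : Scheme.{0}) (υ : F₂ ⟶ (Literature.AlgebraicGeometry.Motives.projectiveSpace n k).left),
      IsBlowup υ (Scheme.IdealSheafData.vanishingIdeal
        (⟨Z, hZ⟩ : Closeds (Literature.AlgebraicGeometry.Motives.projectiveSpace n k).left)) ∧
      ∃ (F' : Scheme.{0}) (γ' : F' ⟶ F₂) (T' E' K' : Set F'),
        (∀ R₁ : (∀ G : Scheme.{0}, (G ⟶ F₂) → Set G → Set G → Set G → Prop),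
          R₁ F₂ (𝟙 F₂) (closure (υ ⁻¹' (Set.range ι \ Z))) (υ ⁻¹' Z) ∅ →
          TowerPtReg₂ (Literature.AlgebraicGeometry.Motives.projectiveSpace n k).left F₂ υ R₁ →
          TowerPtRam₂ (Literature.AlgebraicGeometry.Motives.projectiveSpace n k).left F₂ υ R₁ →
          TowerRound₅ (Literature.AlgebraicGeometry.Motives.projectiveSpace n k).left F₂ υ Z hZ R₁ →
          R₁ F' γ' T' E' K') ∧
        Literature.AlgebraicGeometry.Resolution.Scheme.IsRegular (redSub F' (closure T') isClosed_closure)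

/-- A rational carrier is regular: `RationalCarrier (redSub G Z hZ)` gives regularity of every stalk of `Z̃` (transport of the regularity of
`ℙ¹` over a field along the isomorphism). Used to embed the ₄ disjunct into the ₅ disjunct. [folklore] -/
theorem isRegularLocalRing_stalk_of_rationalCarrier {C : Scheme.{0}} (h : RationalCarrier C) (x : C) :
    IsRegularLocalRing (C.presheaf.stalk x) := by
  obtain ⟨k', _, ⟨e⟩⟩ := h
  haveI : IsRegularLocalRing ((Literature.AlgebraicGeometry.Motives.projectiveSpace 1 k').left.presheaf.stalk (e.hom.base x)) :=
    isRegular_projectiveSpace 1 k' (e.hom.base x)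
  exact IsRegularLocalRing.of_ringEquiv (asIso (e.hom.stalkMap x)).commRingCatIsoToRingEquiv

/-- Closure under `₅`-rounds implies closure under `₄`-rounds (the `₄` rounds are among the `₅` rounds: a rational carrier is regular).
[OURS · pure logic + folklore] -/
theorem towerRound₄_of_towerRound₅ (F₉ F₁₀ : Scheme.{0}) (υ' : F₁₀ ⟶ F₉) (Z₉ : Set F₉) (hZ₉ : IsClosed Z₉)
    (R₁ : ∀ G : Scheme.{0}, (G ⟶ F₁₀) → Set G → Set G → Set G → Prop) (h : TowerRound₅ F₉ F₁₀ υ' Z₉ hZ₉ R₁) :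
    TowerRound₄ F₉ F₁₀ υ' Z₉ hZ₉ R₁ := by
  intro G G' γ T E K hE Z hZ υ₂ K' hR hZET hne hfull hadm hυ₂ hK'
  refine h G G' γ T E K hE Z hZ υ₂ K' hR hZET hne hfull ?_ hυ₂ hK'
  rcases hadm with hsec | ⟨hirr, hrat, hG, hEreg, hunobs⟩
  · exact Or.inl hsec
  · exact Or.inr ⟨hirr, isRegularLocalRing_stalk_of_rationalCarrier hrat, hG, hEreg, hunobs⟩

/-- **TOWER₅ ⊆ TOWER₆** (forgetful). [OURS · pure logic] -/
theorem reachTower₆_of_reachTower₅ (F₁ F₂ : Scheme.{0}) (υ : F₂ ⟶ F₁) (x : F₁) (T₂ : Set F₂) (F' : Scheme.{0}) (β : F' ⟶ F₂)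
    (T' : Set F') (h : ReachTower₅ F₁ F₂ υ x T₂ F' β T') : ReachTower₆ F₁ F₂ υ x T₂ F' β T' := by
  obtain ⟨W, K₂, F₉, β₉, T₉, Z₉, K₉, b₉, hZ₉, F₁₀, υ', γ', E', K', h1, h2, h3, h4, h5, h6, h7, h8, h9, h10, h11, hcl, hβ⟩ := h
  exact ⟨W, K₂, F₉, β₉, T₉, Z₉, K₉, b₉, hZ₉, F₁₀, υ', γ', E', K', h1, h2, h3, h4, h5, h6, h7, h8, h9, h10, h11,
    fun R₁ hseed hreg hram hround => hcl R₁ hseed hreg hram (towerRound₄_of_towerRound₅ F₉ F₁₀ υ' Z₉ hZ₉ R₁ hround), hβ⟩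

/-- **NOSE₅ ⊆ NOSE₆** (forgetful: drop the rational-nose clause, relax the rounds). [OURS · pure logic] -/
theorem reachNoseTower₆_of_reachNoseTower₅ (k : Type) [Field k] (n : ℕ) (H : Scheme.{0})
    (ι : H ⟶ (Literature.AlgebraicGeometry.Motives.projectiveSpace n k).left) (h : ReachNoseTower₅ k n H ι) :
    ReachNoseTower₆ k n H ι := by
  obtain ⟨Z, hZ, h1, h2, h3, h4, -, F₂, υ, hυ, F', γ', T', E', K', hcl, hreg⟩ := h
  exact ⟨Z, hZ, h1, h2, h3, h4, F₂, υ, hυ, F', γ', T', E', K',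
    fun R₁ hseed hreg' hram hround => hcl R₁ hseed hreg' hram (towerRound₄_of_towerRound₅ _ F₂ υ Z hZ R₁ hround), hreg⟩

/-- **NOSE₄ ⊆ NOSE₆** (forgetful, composite). [OURS · pure logic] -/
theorem reachNoseTower₆_of_reachNoseTower₄ (k : Type) [Field k] (n : ℕ) (H : Scheme.{0})
    (ι : H ⟶ (Literature.AlgebraicGeometry.Motives.projectiveSpace n k).left) (h : ReachNoseTower₄ k n H ι) :
    ReachNoseTower₆ k n H ι :=
  reachNoseTower₆_of_reachNoseTower₅ k n H ι (reachNoseTower₅_of_reachNoseTower₄ k n H ι h)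

end Summit.ResolutionOfSingularities.ResolutionOfSingularities.Cruxes.EquisingularLiftNat.Sections

end
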